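import Summits.QuantumAdvantage.QuantumAdvantage.Theses.SosSandwich
import Summits.QuantumAdvantage.QuantumAdvantage.Theses.RandomOracleGauge
import Summits.QuantumAdvantage.QuantumAdvantage.Theorems.MobiusLadderLiouvilleMemBQP
import Literature.Computability.MetaComplexity.HeuristicClasses
import Summits.QuantumAdvantage.QuantumAdvantage.Theorems.SosSandwichRandomOracleHeurSeparationDefs
import Summits.QuantumAdvantage.QuantumAdvantage.Theorems.SosSandwichRandomOracleHeurSeparationStubAlmostAvgPHeur

/-!
# Crux `RandomOracleHeurSeparation` (stmt-QuantumAdvantage-1131; routes SosSandwich rank 4 / RandomOracleGauge rank 3) — birth skeleton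

`Lines/birth.lean` (planner-skel-stmt-QuantumAdvantage-1131-0, skeleton-register / BC3, 2026-08-17).

THE CRUX (X_ROG, hypothesis-type). The conclusion of Aaronson–Ambainis Thm. 7 (iii) FAILS: it is NOT
the case that, with probability `1` over the random oracle `A`, `BQP^A ⊆ AvgP^A` (Aaronson–Ambainis'
heuristic class: one polynomial-time `P^A` transcript machine correct on a `1 − o(1)` fraction of the
inputs of each length). Verbatim
`¬ ∀ᵐ A ∂randomOracle, BQPRel A ⊆ Complexity.AvgPRel (Oracle.ofLanguage A)` — the rev-1 spelling of
route SosSandwich (`…Theses.SosSandwich.RandomOracleHeurSeparation`, item stmt-15239) — and, for the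
item's ACTIVE decl (route RandomOracleGauge, `…Theses.RandomOracleGauge.RandomOracleHeurSeparation`),
the same statement over the reducible synonyms `randomOracleMeasure := randomOracle`
(`OracleSeparations.lean`) and `Barriers.QuantumAdvantage.AvgPRel := Complexity.AvgPRel`
(`RandomOracleMethod.lean`): the two spellings are definitionally equal (reducibly — module docstrings of
`QuantumComplexity/RandomOracleMeasure.lean` and `Complexity/AvgPRel.lean`), so the composing theorem
`RandomOracleHeurSeparation_of` below, which concludes the SosSandwich decl BY NAME, proves the
RandomOracleGauge decl verbatim by `exact` (the route file `Theses.RandomOracleGauge` is deliberately not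
imported here: nothing in the skeleton depends on it).

THE LINE — AN ORACLE-FREE AVERAGE-CASE WITNESS, DE-ORACLED BY BENNETT–GILL. Every reviewer of this
item (refuter 8337d40c, refuter 1e21c1e3, grounder g18-13, grounder g17-21; `ledger workitem get
stmt-QuantumAdvantage-1131`) records the same reading: X_ROG admits — and, as far as anyone knows, ONLY
admits — ORACLE-FREE witnesses: a single language `L ∈ BQP` (hence `L ∈ BQP^A` for every `A`,
`BQP_subset_BQPRel`, proved) that lies OUTSIDE `AvgP^A` for a non-null set of oracles `A`. Bennett–Gill's
random-oracle-hypothesis mechanism (tree: `almostP_subset_BPP_holds`, ALMOST-`P ⊆ BPP`, PROVED in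
`Complexity/AlmostPProofs.lean` — countable pigeonhole over the machines, Lebesgue density on the
random-oracle space `RandomOracleCylinders.lean`, the lazy-sampling identity `LazySampling*.lean`, the
polynomial-time coin-flip simulator `LazySamplingMachine.lean`) says what "outside `AvgP^A` for many
`A`" means WITHOUT the oracle: its average-case form (stub 1 below, ALMOST-`AvgP ⊆ ⋂_{δ>0} Heur_δBPP`
on the uniform ensemble) turns "`L ∈ AvgP^A` almost surely" into "`L` is decided by a probabilistic
polynomial-time heuristic on all but a `δ` fraction of the inputs of each length, for every constant
`δ > 0`" (Bogdanov–Trevisan's `Heur_δBPP`, tree `HeurDeltaBPP`, uniform ensemble `uniformEnsemble`).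
So X_ROG follows from ONE explicit average-case hardness hypothesis about ONE explicit `BQP` language.
The witness chosen is the Liouville language `L_λ = {bin N : λ(N) = −1}` (`Ω(N)` odd) of route
MobiusLadder, because its quantum half is ALREADY A TREE THEOREM
(`Theorems.MobiusLadder.LiouvilleMemBQP_proof`: Shor's factoring theorem `factoring_mem_FBQP_holds` +
one classical wrap), leaving as the single open stub the arithmetic statement (stub 2):
for some constant `δ > 0`, no probabilistic polynomial-time algorithm computes the parity of the
number of prime factors of a uniformly random `n`-bit integer outside a `δ` fraction of them, at
infinitely many `n` — "factoring on the uniform distribution is not heuristically easy", in its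
weakest (`∃ δ`, infinitely-often) form.

COMPOSITION (proved below, no `sorry`): suppose `∀ᵐ A, BQP^A ⊆ AvgP^A`. Since `L_λ ∈ BQP ⊆ BQP^A`
for every `A`, `L_λ ∈ AvgP^A` almost surely, i.e. `L_λ ∈ ALMOST-AvgP`; stub 1 puts `(L_λ, U)` in
`Heur_δBPP` for every `δ > 0`; stub 2 denies that. Hence X_ROG, BY NAME.

WHY THIS IS NOT A COSTUME / NOT SHREDDED. Stub 1 is a genuine theorem (the average-case ALMOST-class
collapse; provable now with the ALMOST-P toolkit, size L: the new analysis is Markov on the error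
fraction + dominated convergence on the density cylinder + a finite patch of small lengths, the
machine is the existing lazy-sampling simulator). Stub 2 is a genuine OPEN arithmetic hypothesis about
one explicit language under one explicit distribution; it is not the crux (no oracle, no measure) and
not the summit (`∃ L ∈ BQP, L ∉ BPP`) restated — it implies the summit only THROUGH two tree theorems
(`LiouvilleMemBQP_proof` and `(BPP, U) ⊆ Heur_δBPP`, `mem_HeurDeltaBPP_of_mem_BPP`), exactly as every
hypothesis-type witness of X_ROG must (grounder g18-13: "of average-case-summit strength";
`Literature.Barriers.QuantumAdvantage.SeparationPrerequisites`). BC3 probes (registering seat,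
NOTES.md): for each stub, `stub → crux` and `stub → QuantumAdvantage` by
`first | exact? | simpa | aesop` (and with the local definitions unfolded) FAIL.

WHAT A REFUTER ATTACKS. Stub 2 dies iff someone exhibits, for EVERY `δ > 0`, a probabilistic
polynomial-time heuristic computing `λ(N)` for all but a `δ` fraction of `n`-bit `N` at all large `n`
— i.e. a factoring-free average-case algorithm for the Liouville function (open: Adleman–McCurley 1994
list; Sarnak 2010, Lecture 1 p. 2, "is computing μ(n) easier than factoring?"). Cheap classical
baselines do NOT threaten it: stripping the `B`-smooth part and guessing is right on
`1/2 + O(log B / n)` of the `n`-bit integers (the cofactor is prime with density `≍ log B / log N`),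
and the Knuth–Trabb Pardo law gives a constant fraction of `N` with second-largest prime factor
`> N^{1/5}`. Stub 1 dies only through a formalisation artefact of `HeurDeltaBPP` / `AvgPRel` (none
known: both are total-language, uniform-length, `none`-counts-as-error conventions).

DISPROOF USED: none exists (`ledger crux ls stmt-QuantumAdvantage-1131`: no workfiles, no
`Disproof.lean`, no landed `Theorems/RandomOracleHeurSeparation/Negative/*`, 2026-08-17); dead lines:
none recorded; `ledger negatives --problem QuantumAdvantage` (6 entries) has nothing on random
oracles, heuristic classes or `λ`.

BARRIERS. `Literature.Barriers.QuantumAdvantage.RandomOracleMethod` (b): SERVED, not evaded — granted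
AAConj (resp. PB-AA) and `PromiseBQP ⊆ PromiseBPP'`, the routes' transfers REFUTE X_ROG, so by this
skeleton they refute stub 2 ∨ stub 1; stub 1 being a theorem, the random-oracle gauge then says
precisely: "Liouville is heuristically BPP-easy on uniform integers" — the skeleton makes the gauge's
unrelativized content explicit. `…SeparationPrerequisites`: applies in full to stub 2 (it implies the
summit via the two tree theorems above, hence `PP ⊄ BPP`); relocated onto one named arithmetic
hypothesis, never claimed provable. `…Relativization` / `…Algebrization` / `…NaturalProofs`: stub 1
relativises harmlessly (it is a simulation theorem); stub 2 is an unrelativized statement about one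
explicit arithmetic function and no circuit lower bound is argued.

STUBS (2) and composition:
* `stub_almostAvgP_heur` — ALMOST-`AvgP ⊆ ⋂_{δ>0} Heur_δBPP` on the uniform ensemble (theorem-type,
  provable now, L; Bennett–Gill 1981 Thm. 5 mechanism in Aaronson–Ambainis' heuristic setting);
* `stub_liouville_heurHard` — `(L_λ, U) ∉ Heur_δBPP` for some constant `δ > 0` (hypothesis-type, OPEN,
  the load-bearing stub);
* `RandomOracleHeurSeparation_of` — the crux BY NAME (SosSandwich spelling; the RandomOracleGauge
  spelling of item 1131 is the same term up to reducible synonyms) from the two stubs (real proof: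
  `BQP_subset_BQPRel`, `LiouvilleMemBQP_proof`, `Filter.Eventually.mono`).
`sorry` occurs ONLY in the remaining `stub_liouville_heurHard` (stub 1 is proved in the tree and imported).

Sources: BennettGill1981 (SIAM J. Comput. 10, Thm. 5; random oracle hypothesis mechanism);
BookVollmerWagner1996 (ICALP, "ALMOST-P = BPP"); FortnowRogers1999JCSS = arXiv:cs/9811023 Thm. 4.4
(proof, p. 8) and §5 (P vs BQP relative to a random oracle, open); AaronsonAmbainis2014 =
arXiv:0911.0996 §1 p. 5 (AvgP), Thm. 7 (iii) / Thm. 23; BogdanovTrevisan2006 Def. 2.13 (`Heur_δBPP`);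
Shor1997 §5 (factoring ∈ FBQP; tree `factoring_mem_FBQP_holds`, `LiouvilleMemBQP_proof`);
AdlemanMcCurley1994 (open problems list: μ/λ vs factoring); Sarnak2010ThreeLectures p. 2;
Knuth–Trabb Pardo, Theoret. Comput. Sci. 3 (1976) (distribution of the second-largest prime factor).
-/

-- `Summit.<Summit>.<Problem>`: for the single-conjunct summit the duplicate `QuantumAdvantage.QuantumAdvantage` is mandated.
set_option linter.dupNamespace false

noncomputable section

namespace Summit.QuantumAdvantage.QuantumAdvantage.Cruxes.RandomOracleHeurSeparation.Birth

open MeasureTheory Filter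
open Literature.Computability.Complexity (AvgPRel Oracle BPP)
open Literature.Computability.Cryptography (BQP BQPRel BQP_subset_BQPRel)
open Literature.Computability.QuantumComplexity (randomOracle)
open Literature.Computability.MetaComplexity (HeurDeltaBPP uniformEnsemble DistProblem)

/-! ## Objects of the line

Re-pointed 2026-08-31 (lead hand leafhand-qadv-sossandwich-1 g0): `liouvilleLang`, `almostAvgP`, `HeurConstBPP` now live
VERBATIM (same namespace, same names) in the importable tree module
`Theorems/SosSandwichRandomOracleHeurSeparationDefs.lean` (p795196), and STUB 1 `stub_almostAvgP_heur` is PROVED in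
`Theorems/SosSandwichRandomOracleHeurSeparationStubAlmostAvgPHeur.lean` (p796426, closed by name on
stmt-QuantumAdvantage-1131; part 1 `…HeurEvents.lean` p796226); the local copies are deleted here (zero renaming). -/

/-! ## The stubs -/

-- stub 1 `stub_almostAvgP_heur` — PROVED, imported (see above).

/-- **stub 2 — the Liouville function is not heuristically `BPP`-computable on uniform integers
(hypothesis-type, OPEN; the load-bearing stub).** There is a constant `δ > 0` such that
`(L_λ, U) ∉ Heur_δBPP`: for every probabilistic polynomial-time algorithm there is a length `n`
(equivalently, by hard-wiring finitely many lengths, infinitely many `n`) at which it errs with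
probability `≥ 1/4` on more than a `δ` fraction of the strings `x ∈ {0,1}ⁿ` — half of which are the
canonical numerals of the `n`-bit integers `N ∈ [2^{n-1}, 2ⁿ)`, on which membership is `λ(N) = −1`
(the other half, ending in `0`, are non-codewords, trivially outside `L_λ`).
Why it might be true: `λ(N) = (−1)^{Ω(N)}` needs the parity of the number of prime factors of the
`B`-rough part of `N`; for uniformly random `N` that cofactor is composite with two prime factors
`> N^{1/5}` on a constant fraction of `N` (Knuth–Trabb Pardo / Dickman-type laws), where no
factoring-free method to decide the parity is known (Adleman–McCurley 1994 open problem; Sarnak 2010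
p. 2), and polynomial-time factoring reaches only integers whose second-largest prime factor has
`polylog` bits (density `→ 0`). The statement is the WEAKEST average-case form (`∃ δ`, infinitely
often, constant inner error), far below "λ is unpredictable" (`δ → 1/2·(1/2)`).
Why it might fail (concrete): a factoring-free heuristic for `λ` on most integers (none known; the
smooth-part-and-guess baseline is right on only `1/2 + O(polylog n / n)` of `n`-bit `N`); or
`FACTORING ∈ BPP` on average over uniform `N` for every constant failure rate (kills it outright, and
with it every factoring-based oracle-free witness of X_ROG). It implies the summit through the tree
theorems `LiouvilleMemBQP_proof` and `(BPP, U) ⊆ Heur_δBPP` — as any hypothesis-type witness of X_ROG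
must (`SeparationPrerequisites`) — but is neither the summit nor the crux restated (one explicit
language, one explicit distribution, no oracle).
Sources: AdlemanMcCurley1994 (open problems in number-theoretic complexity II); Sarnak2010ThreeLectures
p. 2; Knuth–TrabbPardo 1976 (Theoret. Comput. Sci. 3, §4: distribution of the second-largest prime
factor); BogdanovTrevisan2006 Def. 2.13; Shor1997 §5; route MobiusLadder (`LiouvilleNotPPoly`, the
worst-case non-uniform sibling of this statement). -/
theorem stub_liouville_heurHard :
    ∃ δ : ℝ, 0 < δ ∧ (⟨liouvilleLang, uniformEnsemble⟩ : DistProblem) ∉ HeurDeltaBPP (fun _ => δ) := by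
  sorry

/-! ## Name-keyed aliases of the stub statements — the hypotheses of `RandomOracleHeurSeparation_of`

The native skeleton audit (`#h21_check_skeleton`, run by `ledger skeleton check`) admits a hypothesis of
the composing theorem only if its head constant is a registered obligation or is NAMED like a declared
stub; `__Registered.stub_X` is the statement of `stub_X` under the stub's short name (device of
`Cruxes/BQPNotSmall/Lines/birth.lean`). Each alias is an `abbrev`, definitionally its statement. -/
namespace __Registered

/-- Alias of the statement of `stub_liouville_heurHard`. -/
abbrev stub_liouville_heurHard : Prop :=
  ∃ δ : ℝ, 0 < δ ∧ (⟨liouvilleLang, uniformEnsemble⟩ : DistProblem) ∉ HeurDeltaBPP (fun _ => δ)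

end __Registered

/-! Registered-signature agreement: each stub theorem's signature is, definitionally, the alias it is keyed
by (`Iff.rfl`; only TYPES are compared, no `sorry` enters). -/
example : (∃ δ : ℝ, 0 < δ ∧ (⟨liouvilleLang, uniformEnsemble⟩ : DistProblem) ∉ HeurDeltaBPP (fun _ => δ)) ↔
    __Registered.stub_liouville_heurHard := Iff.rfl

/-! ## Proved: the pieces of the composition -/

/-- `L_λ ∈ BQP` — the tree theorem of route MobiusLadder (`LiouvilleMemBQP_proof`: Shor's factoring
theorem `factoring_mem_FBQP_holds` plus one classical wrap), restated for the local name. [cite: Shor1997, §5] -/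
theorem liouvilleLang_mem_BQP : liouvilleLang ∈ BQP :=
  Summit.QuantumAdvantage.QuantumAdvantage.Theorems.MobiusLadder.LiouvilleMemBQP_proof

/-- Stub 2 denies `HeurConstBPP L_λ` (unfolding). [folklore] -/
theorem not_heurConstBPP_liouville
    (h : ∃ δ : ℝ, 0 < δ ∧ (⟨liouvilleLang, uniformEnsemble⟩ : DistProblem) ∉ HeurDeltaBPP (fun _ => δ)) :
    ¬ HeurConstBPP liouvilleLang := by
  rintro hH
  obtain ⟨δ, hδ, hnot⟩ := h
  exact hnot (hH δ hδ)

/-- **The oracle-free witness**: stub 2 and the tree theorem `L_λ ∈ BQP` give a `BQP` language that is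
not heuristically `BPP` with every constant failure rate. [cite: Shor1997, §5] -/
theorem exists_mem_BQP_not_heurConstBPP
    (h : ∃ δ : ℝ, 0 < δ ∧ (⟨liouvilleLang, uniformEnsemble⟩ : DistProblem) ∉ HeurDeltaBPP (fun _ => δ)) :
    ∃ L ∈ BQP, ¬ HeurConstBPP L :=
  ⟨liouvilleLang, liouvilleLang_mem_BQP, not_heurConstBPP_liouville h⟩

/-- **`BQP ⊆ ALMOST-AvgP` under the almost-sure collapse** (the Fortnow–Rogers step, heuristic
version): if `BQP^A ⊆ AvgP^A` for almost every `A`, then every `L ∈ BQP` — being in `BQP^A` for EVERY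
`A` (`BQP_subset_BQPRel`) — is in `AvgP^A` for almost every `A`. [cite: FortnowRogers1999JCSS, Thm. 4.4 (proof, p. 8)] -/
theorem BQP_subset_almostAvgP_of_ae
    (hae : ∀ᵐ (A : Set (List Bool)) ∂randomOracle,
      BQPRel (A : Language Bool) ⊆ AvgPRel (Oracle.ofLanguage (A : Language Bool))) :
    BQP ⊆ almostAvgP := by
  intro L hL
  show ∀ᵐ (A : Set (List Bool)) ∂randomOracle, L ∈ AvgPRel (Oracle.ofLanguage A)
  filter_upwards [hae] with A hA
  exact hA (BQP_subset_BQPRel (A : Language Bool) hL)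

/-- The heart of the line, over the unfolded statement: average-case Bennett–Gill plus an oracle-free
`BQP` witness outside `⋂_δ Heur_δBPP` refute the almost-sure collapse `BQP^A ⊆ AvgP^A`.
[cite: BennettGill1981, Thm. 5] [cite: FortnowRogers1999JCSS, Thm. 4.4] -/
theorem not_ae_collapse
    (hBG : ∀ L : Language Bool, L ∈ almostAvgP → HeurConstBPP L)
    (hW : ∃ L ∈ BQP, ¬ HeurConstBPP L) :
    ¬ ∀ᵐ (A : Set (List Bool)) ∂randomOracle,
      BQPRel (A : Language Bool) ⊆ AvgPRel (Oracle.ofLanguage (A : Language Bool)) := by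
  intro hae
  obtain ⟨L, hL, hnot⟩ := hW
  exact hnot (hBG L (BQP_subset_almostAvgP_of_ae hae hL))

/-! ## Proved: the composition (the crux BY NAME) -/

/-- **THE SKELETON THEOREM.** The crux
`Summit.QuantumAdvantage.QuantumAdvantage.Theses.SosSandwich.RandomOracleHeurSeparation`
(X_ROG: `¬ ∀ᵐ A ∂randomOracle, BQP^A ⊆ AvgP^A`), concluded BY NAME from the remaining stub `stub_liouville_heurHard` and the PROVED stub 1 (`stub_almostAvgP_heur`, imported): were
`BQP^A ⊆ AvgP^A` almost surely, the Liouville language (in `BQP` by Shor, tree theorem) would be in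
ALMOST-`AvgP`, hence (stub 1) heuristically `BPP` with every constant failure rate, which stub 2 denies.
[cite: BennettGill1981, Thm. 5] [cite: AaronsonAmbainis2014, Thm. 7 (iii)] -/
theorem RandomOracleHeurSeparation_of :
    __Registered.stub_liouville_heurHard →
      Summit.QuantumAdvantage.QuantumAdvantage.Theses.SosSandwich.RandomOracleHeurSeparation := by
  intro hHard
  dsimp only [__Registered.stub_liouville_heurHard] at hHard
  unfold Summit.QuantumAdvantage.QuantumAdvantage.Theses.SosSandwich.RandomOracleHeurSeparation
  -- stub 1 is PROVED in the tree (`stub_almostAvgP_heur`, imported): discharge it here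
  exact not_ae_collapse stub_almostAvgP_heur (exists_mem_BQP_not_heurConstBPP hHard)

/-- **The item's ACTIVE decl** (route RandomOracleGauge spelling of stmt-QuantumAdvantage-1131; the SosSandwich
spelling above is item stmt-QuantumAdvantage-15239): the same statement over the reducible synonyms
`randomOracleMeasure := randomOracle` and `Barriers.QuantumAdvantage.AvgPRel := Complexity.AvgPRel`, so the SosSandwich
form proves it by `exact`. The skeleton in its final shape for THIS item (depends on `sorryAx` through
`stub_liouville_heurHard` only). [cite: AaronsonAmbainis2014, Thm. 7 (iii)] -/
theorem RandomOracleHeurSeparation_proof :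
    Summit.QuantumAdvantage.QuantumAdvantage.Theses.RandomOracleGauge.RandomOracleHeurSeparation :=
  RandomOracleHeurSeparation_of stub_liouville_heurHard

/-! ## Sanity (sorry-free): unfolding of the local class predicate -/

/-- The failure-rate function of `HeurConstBPP` at `δ` is the constant `δ` (bookkeeping `Iff.rfl`, used
by provers rewriting into `HeurDeltaBPP` lemmas stated with `fun _ => δ`). [folklore] -/
example (L : Language Bool) :
    HeurConstBPP L ↔ ∀ δ : ℝ, 0 < δ → (⟨L, uniformEnsemble⟩ : DistProblem) ∈ HeurDeltaBPP (fun _ => δ) :=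
  Iff.rfl

end Summit.QuantumAdvantage.QuantumAdvantage.Cruxes.RandomOracleHeurSeparation.Birth

end
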